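import Literature.NumberTheory.Sieve.GreenTao2008SharpGYTuples
import HarnessLib

/-!
# The sharp Goldston–Yıldırım sums for the shift system: local factors (Green–Tao Lemma 10.5)

Towards Green–Tao 2008, Prop. 9.6 (`Literature.NumberTheory.Sieve.GreenTao2008.GoldstonYildirimCorrelations`).
The forms of the correlation condition are `θ_i(x) = W(x + h_i) + 1`, `i ∈ [m]`: ONE variable and all
linear parts equal to `1` — in the tree's `CFZ`/`SharpGY` language the system
`L = (1 : Fin m → Fin 1 → ℤ)`, `b = h`. This system is maximally degenerate (all rows proportional),
so the generic local bounds of `GreenTao2008SharpGYTuples` (`abs_locD_le`, Lemma 10.1) do not apply;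
instead (Lemma 10.5 of the source):

* `localDensity_one_eq` — for `p ∤ W`, `Y ≠ ∅`: `ω_p(Y) = 1/p` if the `h_i (mod p)`, `i ∈ Y`,
  coincide, and `0` otherwise; hence `|T_p(Y)| ≤ 1/p` (`abs_locT_one_le`), and `T_p(Y) = 0` for
  `|π Y| ≥ 2` at a prime dividing no `h_i - h_j` (`locT_one_eq_zero`);
* `sum_abs_locD_one_le` — `∑_Y |Δ_p(Y)| ≤ 2 · 4^m / p` for every prime `p ∤ W`
  (`Δ_p = T_p - T^mod_p` vanishes for `|π Y| ≤ 1` by `SharpGY.locD_eq_zero_of_card_le_one`);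
* `sum_abs_locD_one_le_of_generic` — `∑_Y |Δ_p(Y)| ≤ 4^m / p²` at a prime `p ∤ W` dividing no
  `h_i - h_j`, `i ≠ j` (there `Δ_p = -T^mod_p = O(p⁻²)` on `|π Y| ≥ 2`).

Theorems only. [cite: GreenTaoAnnals2008, Lemma 10.5; Section 10 eq. 10.11]
-/

noncomputable section

open Finset
open scoped BigOperators

namespace Literature.NumberTheory.Sieve.GreenTao2008

namespace GYCorr

open SharpGY CFZ

variable {m : ℕ}

/-- The rows of the shift system are nonzero modulo every prime. [folklore] -/
theorem hrow_one (p : ℕ) [Fact p.Prime] :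
    ∀ i : Fin m, ∃ j : Fin 1, (((1 : Fin m → Fin 1 → ℤ) i j : ℤ) : ZMod p) ≠ 0 :=
  fun _ => ⟨0, by simp⟩

/-- `θ_i(x) = W (x₀ + h_i) + 1` for the shift system. [cite: GreenTaoAnnals2008, Proposition 9.6] -/
theorem wForm_one {R : Type*} [CommRing R] (W : ℕ) (h : Fin m → ℤ) (i : Fin m) (x : Fin 1 → R) :
    CFZ.wForm W ((1 : Fin m → Fin 1 → ℤ) i) (h i) x = (W : R) * (x 0 + (h i : R)) + 1 := by
  unfold CFZ.wForm
  simp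

/-- The solution of `W(u + h_i) + 1 ≡ 0 (mod p)` for `p ∤ W`: `u = -h_i - W⁻¹`.
[cite: GreenTaoAnnals2008, Lemma 10.5 (proof)] -/
theorem wForm_one_eq_zero_iff {p W : ℕ} [Fact p.Prime] (hpW : ¬ p ∣ W) (h : Fin m → ℤ) (i : Fin m)
    (x : Fin 1 → ZMod p) :
    CFZ.wForm W ((1 : Fin m → Fin 1 → ℤ) i) (h i) x = 0 ↔ x 0 = -(h i : ZMod p) - ((W : ZMod p))⁻¹ := by
  rw [wForm_one]
  have hW : (W : ZMod p) ≠ 0 := fun h0 => hpW ((ZMod.natCast_eq_zero_iff W p).1 h0)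
  constructor
  · intro h0
    have h1 : (W : ZMod p) * (x 0 + h i) = -1 := by linear_combination h0
    have h2 : x 0 + h i = -((W : ZMod p))⁻¹ := by
      field_simp
      linear_combination h1
    linear_combination h2
  · intro hx
    rw [hx]
    field_simp
    ring

/-- **Green–Tao's Lemma 10.5 (the local densities of the shift system)**: for `p ∤ W` and `Y ≠ ∅`,
`ω_p(Y) = E_{u ∈ ℤ_p} ∏_{i ∈ Y} 1[W(u+h_i)+1 ≡ 0] = 1/p` if the residues `h_i (mod p)`, `i ∈ Y`, are
all equal, and `0` otherwise. [cite: GreenTaoAnnals2008, Lemma 10.5] -/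
theorem localDensity_one_eq {p W : ℕ} [Fact p.Prime] (hpW : ¬ p ∣ W) (h : Fin m → ℤ)
    {Y : Finset (Fin m)} (hY : Y.Nonempty) :
    CFZ.localDensity p W (1 : Fin m → Fin 1 → ℤ) h Y =
      if ∀ i ∈ Y, ∀ j ∈ Y, (h i : ZMod p) = (h j : ZMod p) then 1 / (p : ℝ) else 0 := by
  classical
  obtain ⟨i₀, hi₀⟩ := hY
  unfold CFZ.localDensity
  set c : Fin m → ZMod p := fun i => -(h i : ZMod p) - ((W : ZMod p))⁻¹ with hc
  have hset : ((univ : Finset (Fin 1 → ZMod p)).filter fun x =>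
      ∀ i ∈ Y, CFZ.wForm W ((1 : Fin m → Fin 1 → ℤ) i) (h i) x = 0) =
      (univ : Finset (Fin 1 → ZMod p)).filter fun x => ∀ i ∈ Y, x 0 = c i :=
    filter_congr fun x _ => by simp only [wForm_one_eq_zero_iff hpW, hc]
  rw [hset, pow_one]
  by_cases hmono : ∀ i ∈ Y, ∀ j ∈ Y, (h i : ZMod p) = (h j : ZMod p)
  · rw [if_pos hmono]
    have hc' : ∀ i ∈ Y, c i = c i₀ := fun i hi => by rw [hc]; simp only; rw [hmono i hi i₀ hi₀]
    have hone : ((univ : Finset (Fin 1 → ZMod p)).filter fun x => ∀ i ∈ Y, x 0 = c i) = {fun _ => c i₀} := by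
      ext x
      simp only [mem_filter, mem_univ, true_and, mem_singleton]
      constructor
      · intro hx
        funext k
        rw [Fin.fin_one_eq_zero k, hx i₀ hi₀]
      · rintro rfl i hi
        exact (hc' i hi).symm
    rw [hone, card_singleton, Nat.cast_one]
  · rw [if_neg hmono]
    have hempty : ((univ : Finset (Fin 1 → ZMod p)).filter fun x => ∀ i ∈ Y, x 0 = c i) = ∅ := by
      rw [filter_eq_empty_iff]
      intro x _ hx
      apply hmono
      intro i hi j hj
      have h2 := hx j hj
      rw [hx i hi, hc] at h2
      simp only at h2
      linear_combination -h2
    rw [hempty, card_empty, Nat.cast_zero, zero_div]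

/-- `0 ≤ ω_p(Y) ≤ 1/p` for `Y ≠ ∅` (`p ∤ W`). [cite: GreenTaoAnnals2008, Lemma 10.5] -/
theorem localDensity_one_le {p W : ℕ} [Fact p.Prime] (hpW : ¬ p ∣ W) (h : Fin m → ℤ)
    {Y : Finset (Fin m)} (hY : Y.Nonempty) :
    0 ≤ CFZ.localDensity p W (1 : Fin m → Fin 1 → ℤ) h Y ∧
      CFZ.localDensity p W (1 : Fin m → Fin 1 → ℤ) h Y ≤ 1 / (p : ℝ) := by
  rw [localDensity_one_eq hpW h hY]
  split_ifs
  · exact ⟨by positivity, le_rfl⟩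
  · exact ⟨le_rfl, by positivity⟩

/-- At a prime not dividing any `h_i - h_j` (`i ≠ j`), `ω_p(Y) = 0` for `|Y| ≥ 2`.
[cite: GreenTaoAnnals2008, Lemma 10.5] -/
theorem localDensity_one_eq_zero {p W : ℕ} [Fact p.Prime] (hpW : ¬ p ∣ W) {h : Fin m → ℤ}
    (hgen : ∀ i j : Fin m, i ≠ j → ¬ (p : ℤ) ∣ h i - h j) {Y : Finset (Fin m)} (hY : 1 < Y.card) :
    CFZ.localDensity p W (1 : Fin m → Fin 1 → ℤ) h Y = 0 := by
  obtain ⟨i, hi, j, hj, hij⟩ := one_lt_card.1 hY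
  rw [localDensity_one_eq hpW h ⟨i, hi⟩, if_neg]
  intro hmono
  have h1 := hmono i hi j hj
  apply hgen i j hij
  have : ((h i - h j : ℤ) : ZMod p) = 0 := by push_cast; rw [h1, sub_self]
  exact (ZMod.intCast_zmod_eq_zero_iff_dvd _ p).1 this

/-! ### The local factors `T_p`, `Δ_p` of the shift system -/

/-- `|T_p(Y)| ≤ 1/p` for `Y ≠ ∅` (`p` prime, `p ∤ W`). [cite: GreenTaoAnnals2008, Lemma 10.5] -/
theorem abs_locT_one_le {p W : ℕ} [Fact p.Prime] (hpW : ¬ p ∣ W) (h : Fin m → ℤ)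
    {Y : Finset (Fin m ⊕ Fin m)} (hY : Y ≠ ∅) : |locT p W (1 : Fin m → Fin 1 → ℤ) h Y| ≤ 1 / (p : ℝ) := by
  haveI : NeZero p := ⟨(Fact.out : p.Prime).ne_zero⟩
  have hne : (projPattern Y).Nonempty := projPattern_nonempty (nonempty_iff_ne_empty.2 hY)
  unfold locT
  rw [localDensity₀_eq, abs_mul, abs_pow, abs_neg, abs_one, one_pow, one_mul,
    abs_of_nonneg (localDensity_one_le hpW h hne).1]
  exact (localDensity_one_le hpW h hne).2

/-- At a generic prime (`p ∤ W`, `p ∤ h_i - h_j` for `i ≠ j`), `T_p(Y) = 0` when `Y` couples two forms.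
[cite: GreenTaoAnnals2008, Lemma 10.5] -/
theorem locT_one_eq_zero {p W : ℕ} [Fact p.Prime] (hpW : ¬ p ∣ W) {h : Fin m → ℤ}
    (hgen : ∀ i j : Fin m, i ≠ j → ¬ (p : ℤ) ∣ h i - h j) {Y : Finset (Fin m ⊕ Fin m)}
    (hY : 2 ≤ (projPattern Y).card) : locT p W (1 : Fin m → Fin 1 → ℤ) h Y = 0 := by
  haveI : NeZero p := ⟨(Fact.out : p.Prime).ne_zero⟩
  unfold locT
  rw [localDensity₀_eq, localDensity_one_eq_zero hpW hgen (by omega), mul_zero]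

/-- `|Δ_p(Y)| ≤ 2/p` for every pattern (`p ∤ W`): `Δ_p = 0` unless `|π Y| ≥ 2`, where
`|T_p| ≤ 1/p` and `|T^mod_p| ≤ 1/p²`. [cite: GreenTaoAnnals2008, Section 10 eq. 10.11] -/
theorem abs_locD_one_le {p W : ℕ} [Fact p.Prime] (hpW : ¬ p ∣ W) (h : Fin m → ℤ)
    (Y : Finset (Fin m ⊕ Fin m)) : |locD p W (1 : Fin m → Fin 1 → ℤ) h Y| ≤ 2 / (p : ℝ) := by
  have hp := (Fact.out : p.Prime)
  have hp0 : (0 : ℝ) < p := by exact_mod_cast hp.pos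
  have hp1 : (1 : ℝ) ≤ p := by exact_mod_cast hp.one_lt.le
  rcases Nat.lt_or_ge (projPattern Y).card 2 with hc | hc
  · rw [locD_eq_zero_of_card_le_one hpW (1 : Fin m → Fin 1 → ℤ) h (hrow_one p) (by omega), abs_zero]
    positivity
  · have hY : Y ≠ ∅ := by
      intro hY0; subst hY0; simp at hc
    unfold locD
    calc |locT p W (1 : Fin m → Fin 1 → ℤ) h Y - locM p W Y|
        ≤ |locT p W (1 : Fin m → Fin 1 → ℤ) h Y| + |locM p W Y| := abs_sub _ _
      _ ≤ 1 / (p : ℝ) + 1 / (p : ℝ) ^ 2 := add_le_add (abs_locT_one_le hpW h hY) (abs_locM_le_of_two_le hpW hc)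
      _ ≤ 2 / (p : ℝ) := by
          have h1 : 1 / (p : ℝ) ^ 2 ≤ 1 / p := by
            rw [one_div_le_one_div (by positivity) hp0]; nlinarith
          have h2 : (2 : ℝ) / p = 1 / p + 1 / p := by ring
          linarith

/-- At a generic prime, `|Δ_p(Y)| ≤ 1/p²` for every pattern. [cite: GreenTaoAnnals2008, Section 10 eq. 10.8] -/
theorem abs_locD_one_le_of_generic {p W : ℕ} [Fact p.Prime] (hpW : ¬ p ∣ W) {h : Fin m → ℤ}
    (hgen : ∀ i j : Fin m, i ≠ j → ¬ (p : ℤ) ∣ h i - h j) (Y : Finset (Fin m ⊕ Fin m)) :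
    |locD p W (1 : Fin m → Fin 1 → ℤ) h Y| ≤ 1 / (p : ℝ) ^ 2 := by
  rcases Nat.lt_or_ge (projPattern Y).card 2 with hc | hc
  · rw [locD_eq_zero_of_card_le_one hpW (1 : Fin m → Fin 1 → ℤ) h (hrow_one p) (by omega), abs_zero]
    positivity
  · unfold locD
    rw [locT_one_eq_zero hpW hgen hc, zero_sub, abs_neg]
    exact abs_locM_le_of_two_le hpW hc

/-- **`∑_Y |Δ_p(Y)| ≤ 2 · 4^m / p`** at every prime `p ∤ W` (`4^m` patterns).
[cite: GreenTaoAnnals2008, Section 10 eq. 10.11 (λ_p = O(1/p), E_p^{(0)} = 1 + O(1/p))] -/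
theorem sum_abs_locD_one_le {p W : ℕ} [Fact p.Prime] (hpW : ¬ p ∣ W) (h : Fin m → ℤ) :
    ∑ Y : Finset (Fin m ⊕ Fin m), |locD p W (1 : Fin m → Fin 1 → ℤ) h Y| ≤ 2 * 4 ^ m / (p : ℝ) := by
  calc ∑ Y : Finset (Fin m ⊕ Fin m), |locD p W (1 : Fin m → Fin 1 → ℤ) h Y|
      ≤ ∑ _Y : Finset (Fin m ⊕ Fin m), 2 / (p : ℝ) := sum_le_sum fun Y _ => abs_locD_one_le hpW h Y
    _ = 2 * 4 ^ m / (p : ℝ) := by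
        rw [sum_const, card_univ, Fintype.card_finset, Fintype.card_sum, Fintype.card_fin, nsmul_eq_mul]
        push_cast
        rw [← two_mul, pow_mul]
        norm_num
        ring

/-- **`∑_Y |Δ_p(Y)| ≤ 4^m / p²`** at a generic prime (`p ∤ W`, `p ∤ h_i - h_j` for `i ≠ j`).
[cite: GreenTaoAnnals2008, Section 10 eq. 10.8 (E_p^{(1)} = 1 + O(p⁻²))] -/
theorem sum_abs_locD_one_le_of_generic {p W : ℕ} [Fact p.Prime] (hpW : ¬ p ∣ W) {h : Fin m → ℤ}
    (hgen : ∀ i j : Fin m, i ≠ j → ¬ (p : ℤ) ∣ h i - h j) :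
    ∑ Y : Finset (Fin m ⊕ Fin m), |locD p W (1 : Fin m → Fin 1 → ℤ) h Y| ≤ 4 ^ m / (p : ℝ) ^ 2 := by
  calc ∑ Y : Finset (Fin m ⊕ Fin m), |locD p W (1 : Fin m → Fin 1 → ℤ) h Y|
      ≤ ∑ _Y : Finset (Fin m ⊕ Fin m), 1 / (p : ℝ) ^ 2 := sum_le_sum fun Y _ => abs_locD_one_le_of_generic hpW hgen Y
    _ = 4 ^ m / (p : ℝ) ^ 2 := by
        rw [sum_const, card_univ, Fintype.card_finset, Fintype.card_sum, Fintype.card_fin, nsmul_eq_mul]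
        push_cast
        rw [← two_mul, pow_mul]
        norm_num
        ring

end GYCorr

end Literature.NumberTheory.Sieve.GreenTao2008
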